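import Literature.Probability.RandomPlanarGeometry.HexSAWSurfaceYcLimitAllY
import Literature.Probability.RandomPlanarGeometry.HexSAWSurfaceWallRateSqrtMonotone
import HarnessLib

/-!
# The half-plane surface rate `μ(y)` of honeycomb SAW grows at most like `√y`: `μ(y') ≤ √(y'/y) μ(y)`, and the explicit window
# `√y ≤ μ(y) ≤ μ_ℍ √(y/(1+√2)) = 2^{1/4} √y` for every `y ≥ 1 + √2`

Topic `Literature/Probability/RandomPlanarGeometry` (combines `HexSAWSurfaceYcLimitAllY.lean` — `HV.surfaceMu y = max (wallRate y) μ_ℍ`,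
the limit `C_n(y)^{1/n} → μ(y)` of BBdGDCG14 Proposition 5 for every `y > 0`, `surfaceMu_eq_iff : μ(y) = μ_ℍ ↔ y ≤ 1+√2`,
`max_le_surfaceMu : max(μ_ℍ, √y) ≤ μ(y)` — with `HexSAWSurfaceWallRateSqrtMonotone.lean` — `Wall.wallRate_le_sqrt_mul :
β(y') ≤ √(y'/y) β(y)`, `Wall.wallRate_mono`).  Names: the lane's Prop-5 rider file `HexSAWSurfaceYcProp5Riders` owns
`HV.surfaceMu_le_sqrt_mul : 1 ≤ y → μ(y) ≤ √y·μ_ℍ`; the two-fugacity law here is `surfaceMu_le_sqrt_div_mul`.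

Source of the frame: N. R. Beaton, M. Bousquet-Mélou, J. de Gier, H. Duminil-Copin, A. J. Guttmann, CMP 326 (2014), §3.1, Proposition 5
(arXiv:1109.0358v5 p. 9: "`μ(y) ≥ max(μ, √y)`", "a log-convex, non-decreasing function of `log y`"; pp. 9–10, after the proof: "This translates
into `μ(y) ∼ √y` in our honeycomb setting", after Rychlewski–Whittington for the square lattice) and Theorem 2 (p. 3: `y_c = 1 + √2`).
What is printed is the lower bound `√y`, the order `√y` at infinity and the value of `y_c`; the statements below — the monotone
decay of `μ(y)/√y` and the resulting TWO-SIDED window with explicit constants at EVERY `y ≥ y_c`, `1 ≤ μ(y)/√y ≤ μ_ℍ/√(1+√2) =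
2^{1/4} = 1.189…` (exact: `μ_ℍ² = 2 + √2 = √2·(1+√2)`; the upper end is attained at `y = y_c`) — are elementary consequences which we have not
found in print (label of record, lit-1 g17 2026-08-24: LANE COROLLARY XS / NEW-IN-WRITING XS, modest; the exact constant `2^{1/4}` was pointed out by
a-ref-2 g50 / a-ref-1 g54).  EDITIONS: ed.3 ecb284a1252c3de4 (a-p5 g12); ed.4 (this, a-p5 g15) = ed.3 code VERBATIM + the three declarations
`hexConnectiveConstant_div_sqrt_one_add_sqrt_two`, private `sqrt_sqrt_two_eq_rpow`, `surfaceMu_div_sqrt_mem_Icc_rpow` and this paragraph (ed.4 9cdc266bcfe67a8b);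
ed.5 = ed.4 + token SE-1 (lit-1 g20: the private lemma's tag is `[folklore]`), DOCSTRING-ONLY.

## Contents (namespace `Literature.Probability.RandomPlanarGeometry.SAW.HV`, all PROVED)

* **`surfaceMu_le_sqrt_div_mul`** — `0 < y ≤ y' → μ(y') ≤ √(y'/y) · μ(y)`; `antitoneOn_surfaceMu_div_sqrt`;
* **`surfaceMu_le_mul_sqrt_div`** — `1 + √2 ≤ y → μ(y) ≤ μ_ℍ · √(y / (1+√2))`;
* **`surfaceMu_div_sqrt_mem_Icc`** — `1 + √2 ≤ y → μ(y)/√y ∈ [1, μ_ℍ/√(1+√2)]`;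
* `hexConnectiveConstant_div_sqrt_one_add_sqrt_two` — `μ_ℍ/√(1+√2) = √(√2)` (`= 2^{1/4}`, private `sqrt_sqrt_two_eq_rpow`),
  **`surfaceMu_div_sqrt_mem_Icc_rpow`** — `1 + √2 ≤ y → μ(y)/√y ∈ [1, 2^{1/4}]`.
-/

noncomputable section

open Literature.Probability.LatticeModels Literature.Probability.Percolation
open Literature.Probability.RandomPlanarGeometry.SAW.HexBW.Wall

namespace Literature.Probability.RandomPlanarGeometry.SAW.HV

variable {y : ℝ}

/-- **`μ(y') ≤ √(y'/y) · μ(y)` for `0 < y ≤ y'`.**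
[cite: BeatonBousquetMelouDeGierDuminilCopinGuttmann2014, §3.1, Proposition 5 (arXiv v5 p. 9: log-convexity; p. 10, top: "μ(y) ∼ √y in our honeycomb setting")] -/
theorem surfaceMu_le_sqrt_div_mul (hy : 0 < y) {y' : ℝ} (hyy' : y ≤ y') : surfaceMu y' ≤ Real.sqrt (y' / y) * surfaceMu y := by
  have hy' : 0 < y' := lt_of_lt_of_le hy hyy'
  have hs1 : 1 ≤ Real.sqrt (y' / y) := by
    rw [← Real.sqrt_one]; exact Real.sqrt_le_sqrt ((one_le_div hy).2 hyy')
  have hμ := hexConnectiveConstant_pos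
  unfold surfaceMu
  refine max_le ?_ ?_
  · exact (HexBW.Wall.wallRate_le_sqrt_mul hy hyy').trans (mul_le_mul_of_nonneg_left (le_max_left _ _) (by positivity))
  · calc hexConnectiveConstant = 1 * hexConnectiveConstant := (one_mul _).symm
      _ ≤ Real.sqrt (y' / y) * max (wallRate y) hexConnectiveConstant :=
          mul_le_mul hs1 (le_max_right _ _) hμ.le (by positivity)

/-- **`μ(y)/√y` is non-increasing on `(0, ∞)`.**
[cite: BeatonBousquetMelouDeGierDuminilCopinGuttmann2014, §3.1, Proposition 5 (arXiv v5 p. 9)] -/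
theorem antitoneOn_surfaceMu_div_sqrt : AntitoneOn (fun y : ℝ => surfaceMu y / Real.sqrt y) (Set.Ioi 0) := by
  intro y hy y' _ hyy'
  have hy0 : (0:ℝ) < y := hy
  have hy' : 0 < y' := lt_of_lt_of_le hy0 hyy'
  have h := surfaceMu_le_sqrt_div_mul hy0 hyy'
  have hsy' : 0 < Real.sqrt y' := Real.sqrt_pos.2 hy'
  rw [Real.sqrt_div hy'.le] at h
  show surfaceMu y' / Real.sqrt y' ≤ surfaceMu y / Real.sqrt y
  rw [div_le_iff₀ hsy']
  calc surfaceMu y' ≤ Real.sqrt y' / Real.sqrt y * surfaceMu y := h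
    _ = surfaceMu y / Real.sqrt y * Real.sqrt y' := by ring

/-- **The square-root envelope from the critical point: `μ(y) ≤ μ_ℍ · √(y/(1+√2))` for every `y ≥ 1 + √2`** (since `μ(1+√2) = μ_ℍ`).
[cite: BeatonBousquetMelouDeGierDuminilCopinGuttmann2014, Theorem 2 (arXiv v5 p. 3: y_c = 1+√2) and §3.1, Proposition 5 (p. 9)] -/
theorem surfaceMu_le_mul_sqrt_div (hy : 1 + Real.sqrt 2 ≤ y) :
    surfaceMu y ≤ hexConnectiveConstant * Real.sqrt (y / (1 + Real.sqrt 2)) := by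
  have hc : 0 < 1 + Real.sqrt 2 := by positivity
  have h := surfaceMu_le_sqrt_div_mul hc hy
  have hyc : surfaceMu (1 + Real.sqrt 2) = hexConnectiveConstant := (surfaceMu_eq_iff hc).2 le_rfl
  rw [hyc] at h
  linarith [h, mul_comm (Real.sqrt (y / (1 + Real.sqrt 2))) hexConnectiveConstant]

/-- **The two-sided window `1 ≤ μ(y)/√y ≤ μ_ℍ/√(1+√2)` for every `y ≥ 1 + √2`.**
[cite: BeatonBousquetMelouDeGierDuminilCopinGuttmann2014, §3.1, Proposition 5 (arXiv v5 p. 9: "μ(y) ≥ max(μ, √y)"; p. 10, top: "μ(y) ∼ √y") and Theorem 2 (p. 3)] -/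
theorem surfaceMu_div_sqrt_mem_Icc (hy : 1 + Real.sqrt 2 ≤ y) :
    surfaceMu y / Real.sqrt y ∈ Set.Icc 1 (hexConnectiveConstant / Real.sqrt (1 + Real.sqrt 2)) := by
  have hc : 0 < 1 + Real.sqrt 2 := by positivity
  have hy0 : 0 < y := lt_of_lt_of_le hc hy
  have hsy : 0 < Real.sqrt y := Real.sqrt_pos.2 hy0
  constructor
  · rw [le_div_iff₀ hsy, one_mul]
    exact (le_max_right _ _).trans (max_le_surfaceMu hy0)
  · rw [div_le_iff₀ hsy]
    have h := surfaceMu_le_mul_sqrt_div hy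
    rw [Real.sqrt_div hy0.le] at h
    calc surfaceMu y ≤ hexConnectiveConstant * (Real.sqrt y / Real.sqrt (1 + Real.sqrt 2)) := h
      _ = hexConnectiveConstant / Real.sqrt (1 + Real.sqrt 2) * Real.sqrt y := by ring

/-- **The window constant is exact: `μ_ℍ / √(1+√2) = √(√2) = 2^{1/4} = 1.18920…`** (because `μ_ℍ² = 2 + √2 = √2 · (1 + √2)`).
[cite: DuminilCopinSmirnov2012, Theorem 1 (μ_ℍ = √(2+√2))] -/
theorem hexConnectiveConstant_div_sqrt_one_add_sqrt_two :
    hexConnectiveConstant / Real.sqrt (1 + Real.sqrt 2) = Real.sqrt (Real.sqrt 2) := by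
  have h2 : (0:ℝ) ≤ Real.sqrt 2 := Real.sqrt_nonneg 2
  have hs : Real.sqrt 2 * Real.sqrt 2 = 2 := Real.mul_self_sqrt (by norm_num)
  rw [hexConnectiveConstant_eq_of_thm1 DuminilCopinSmirnov2012_thm1_holds, ← Real.sqrt_div' _ (by positivity)]
  congr 1
  rw [div_eq_iff (by positivity : (1 + Real.sqrt 2) ≠ 0)]
  nlinarith [hs]

/-- `√(√2) = 2^{1/4}` (private arithmetic plumbing). [folklore] -/
private theorem sqrt_sqrt_two_eq_rpow : Real.sqrt (Real.sqrt 2) = (2:ℝ) ^ (1/4 : ℝ) := by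
  rw [Real.sqrt_eq_rpow, Real.sqrt_eq_rpow, ← Real.rpow_mul (by norm_num : (0:ℝ) ≤ 2)]
  norm_num

/-- **The two-sided window with the exact constant: `1 ≤ μ(y)/√y ≤ 2^{1/4}` for every `y ≥ 1 + √2`** (the upper end is attained at
`y = y_c = 1 + √2`, where `μ(y_c) = μ_ℍ`).
[cite: BeatonBousquetMelouDeGierDuminilCopinGuttmann2014, §3.1, Proposition 5 (arXiv v5 p. 9) and Theorem 2 (p. 3); DuminilCopinSmirnov2012, Theorem 1] -/
theorem surfaceMu_div_sqrt_mem_Icc_rpow (hy : 1 + Real.sqrt 2 ≤ y) :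
    surfaceMu y / Real.sqrt y ∈ Set.Icc 1 ((2:ℝ) ^ (1/4 : ℝ)) := by
  rw [← sqrt_sqrt_two_eq_rpow, ← hexConnectiveConstant_div_sqrt_one_add_sqrt_two]
  exact surfaceMu_div_sqrt_mem_Icc hy

end Literature.Probability.RandomPlanarGeometry.SAW.HV
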